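import Summits.Ventures.HSemireg.FormulaNUniform
import Summits.Ventures.HSemireg.FormulaNSqueeze

/-!
# Venture HSemireg — FORMULA-N, the UNIFORM-IN-n STATEMENT (2/3): the K-ISOTYPIC SATURATION LAW (S1)–(S5) as a named skeleton —
# abstract saturation uniform in `n`, the MOD-4 parity arithmetic, and the conjecture's n-pattern

HONEST FRAMING. Part of the Lean index of the computation cell `pub-hsemireg` (seat p10, Sunday typer «UNIFORM-IN-n»).
Finite-dimensional LINEAR ALGEBRA over a field and ARITHMETIC ONLY: no variety, no cohomology theory, no sheaf, no
semiregularity map is constructed here; nothing here says that HC / HC_CM / HC_AV holds; no Literature fact is declared or used.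
The words of STRUCTURE.md v1.0-FINAL `9059cdf4f7e18671` §2 «(S) PRIMARY — THE K-ISOTYPIC SATURATION LAW = THEOREM (S1)–(S3)
[seat-proved, th-7; (S3) given ∫bⁿ > 0] + OPEN (S4) [the conjecture proper] + COMPLEMENT (S5)» (VERDICT-G6.md v1.0 SIGNED
`1651dcc7322662a2` § FORMULA-N / STRUCTURE: «(S1)/(S2) PROVED at seat tier …, (S3) MOD-4 PARITY LAW PROVED given ∫bⁿ > 0 under
(H1)–(H3), REFEREE-READ ref-4 13:46:16Z, (S4) THE CONJECTURE PROPER — OPEN, n = 5 witness test = family S: no witness, (S5)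
complement shape») are TYPED here as follows; the geometric inputs are HYPOTHESES BY VALUE, the dictionary is quoted, not asserted.

* §4 (S1)+(S2) — the saturation mechanism, ABSTRACT and uniform in `n` (setting of record: `X` an abelian `n`-fold, `A = X × X′`
  with a Weil structure of signature `(n,n)`, `E = Φ(F ⊠ F′)(⊗ M)` a BOX of two N-transversal 2-secant factors, `σ_E` the total
  Buchweitz–Flenner map, `ev_E : HT²(A) → Ext²(E,E)`): for linear maps `ev : HT² → Ext²`, `σ : Ext² → H` with the BRIDGE
  `σ ∘ ev = c` (HYPOTHESIS: [BuchweitzFlenner2008HH] Thm 6.4.2 / Prop 6.4.4, on paper; STRUCTURE D4 / (BF)) and `rank c = R₂(n)`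
  (the CLASS side — a tree theorem on the wedge model, file 3/3, and on the real carriers `contractionRank_pointPairBox`),
  `dim HT² = C(4n,2)` (typed in any degree `k`; the signed words are `k = 2`): `s1_fourNumbers` — «the four numbers `(dim HT²(A), dim Ext²(E,E), rank σ_E∘ev_E = rank ⌟ch(E),
  dim ker ⌟ch(E)) = (8n² − 2n, R₂(n) + δ_E, R₂(n), 8n² − 2n − R₂(n))` with `δ_E ≥ 0`» in the form `(dimHT n 2, R₂(n) + δ,
  R₂(n), kerDim n 2)`; `s2_saturation` — «`δ_E = 0 ⇒ σ_E` injective (saturation: `ev` onto)», with `dim ker ev = kerDim n 2`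
  (`= 2n²` for `n ≥ 3`, `FormulaN.Uniform.kerDim_two`) — th-6 THEOREM S (`FormulaN.Squeeze.theoremS`) at the FORMULA-N numbers.
  NOT typed: the Ext-side law «`dim Ext²(E,E) = R₂(n) + δ_E` with `δ_E = 0` exactly for EXTREMAL factors» (th-7 Σ3 / EXT-NOTE
  Thm 1.1, on paper — it enters as the hypothesis `hExt`), «in EVERY degree», the image/kernel AS SUBSPACES (K-isotypic pieces of
  weights `∓(n−k)`; frame-dependent), and (S2)'s converse for `n ≤ 4`.
* §5 (S3) MOD-4 PARITY LAW — ARITHMETIC SKELETON (STRUCTURE C12 / (S3); th-7 Σ6): `chiExtremal n := P_n(−1) = −1 − (−1)^n`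
  (`n ≥ 1`; `−2` even, `0` odd); a `ParityDatum n` packages BY VALUE what a hypothetical `G`-equivariant (`G ⊂` translations,
  free) secant-type object with the extremal («Lemma») `G`-invariant profile on an abelian `n`-fold would supply — `|G| ≥ 1`, the
  Mukai self-pairing `(v,v)_χ ∈ ℤ`, (H1) its sign `(−1)^{n/2}` for `n` even (HRR given `∫_X bⁿ > 0`, ARGUED from polarisability —
  hypothesis of record), (H-profile) `(v,v)_χ = |G|·P_n(−1)`; `parityDatum_false_of_four_dvd` («`n ≡ 0 (mod 4)`: no such object»;
  at `n = 4` this is the Lemma-profile half of NOGO-n4 / Q824-NO — its «no `G`-semiregular secant object at all» half uses the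
  Σ5 pinch and is not typed) and `two_mul_cardG_eq` («`n ≡ 2 (mod 4)`: `|G| = −(v,v)_χ/2`», T4a: `|G| = 1`).  (H2)/(H3) and the
  HRR computation are not typed.
* §6 (S4) THE CONJECTURE PROPER and the law's n-PATTERN as a SHAPE over an existence predicate `E : ℕ → Prop` («an extremal
  CLASS-ALIVE N-transversal 2-secant factor exists on some abelian `n`-fold; hence a semiregular class-exact box on the split Weil
  component `(n, K, (−1)ⁿ·Nm)`»), which the tree CANNOT yet define (no carrier for the Ext-profile and the class condition of a
  sheaf on an abelian `n`-fold; the cell's `extRank` / `contractionRank` of `PerfectComplexRankDoor.lean` are the nearest real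
  carriers — `TODO(real carrier)`): `S4Record E = E 2 ∧ E 3` (OF RECORD: T4a / [Mar25] fourfolds; t-13 C13-8 THETA/family C, ×2;
  split components, method instances), `S3Exclusion E` (PROVED on paper given (H1): `s3Exclusion_of_parityDatum`),
  `S4Conjecture E = E 5 ∧ ∀ n ≥ 6, n ≡ 2 (mod 4) → E n` (OPEN; n = 5 witness test of record = family S «8/8 NOT semiregular ×2
  EXACT; no witness», R-81 (a), VERDICT § g = 10; the `n = 6` rung sieved, p1 N6-SIEVE), bundled as `SaturationLawShape E` with
  separately-tiered fields, and `saturationLawShape_consistent` (the three fields do not contradict each other).  (S5) — «away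
  from secant type the obstruction is LOCALISED in named pieces with closed-form dimension» — and the SCOPE CAVEAT «every
  secant-structure row lives on a SPLIT component; (S) decides nothing at its own g; its deciding power is the LADDER» are quoted
  only.  Schemas, never asserted: no `theorem` here concludes `E n` for any geometric `E`.
-/

open Polynomial Finset Module

namespace Summit.Ventures.HSemireg.FormulaN.Uniform

/-! ## §4. (S1) + (S2): the saturation mechanism, abstract and uniform in `n` -/

section Saturation

variable {K : Type*} [Field K]
variable {HT2 Ext2 Tgt : Type*} [AddCommGroup HT2] [Module K HT2] [AddCommGroup Ext2] [Module K Ext2]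
  [AddCommGroup Tgt] [Module K Tgt] [FiniteDimensional K HT2] [FiniteDimensional K Ext2]

omit [FiniteDimensional K HT2] in
/-- `δ_E ≥ 0` ((S1) second number; any degree `k`): with the bridge `σ ∘ ev = c` and `rank c = R_k(n)`,
`R_k(n) ≤ dim Ext^k(E,E)` — the composite factors through `Ext^k`. -/
theorem boxRank_le_finrank_ext (ev : HT2 →ₗ[K] Ext2) (σ : Ext2 →ₗ[K] Tgt) (c : HT2 →ₗ[K] Tgt)
    (bridge : σ ∘ₗ ev = c) {n k : ℕ} (hc : finrank K (LinearMap.range c) = boxRank n k) :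
    boxRank n k ≤ finrank K Ext2 := by
  rw [← hc, ← bridge]
  exact Squeeze.finrank_range_comp_le_mid ev σ

/-- **(S1) THE FOUR NUMBERS**, abstract form (STRUCTURE §2 (S1)), in any degree `k` (the signed words are the case `k = 2`):
for `ev : HT^k → Ext^k`, `σ : Ext^k → H` with the bridge `σ ∘ ev = c` (hypothesis; [BF08] Thm 6.4.2 on paper), `rank c = R_k(n)`
(the class side — a tree theorem on the wedge model, `FormulaNUniformKernel.lean`) and `dim HT^k = C(4n,k)`:
`(dim HT^k, dim Ext^k, rank σ∘ev, dim ker c) = (dimHT n k, R_k(n) + δ_E, R_k(n), kerDim n k)` with `δ_E ≥ 0`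
(`k = 2`, `n ≥ 3`: `= (8n² − 2n, 6n² − 2n + δ_E, 6n² − 2n, 2n²)` by `dimHT_two` / `boxRank_two` / `kerDim_two`). -/
theorem s1_fourNumbers (ev : HT2 →ₗ[K] Ext2) (σ : Ext2 →ₗ[K] Tgt) (c : HT2 →ₗ[K] Tgt) (bridge : σ ∘ₗ ev = c)
    {n k : ℕ} (hHT : finrank K HT2 = dimHT n k) (hc : finrank K (LinearMap.range c) = boxRank n k) :
    finrank K HT2 = dimHT n k ∧ (∃ δ : ℕ, finrank K Ext2 = boxRank n k + δ) ∧
      finrank K (LinearMap.range (σ ∘ₗ ev)) = boxRank n k ∧ finrank K (LinearMap.ker c) = kerDim n k := by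
  refine ⟨hHT, ⟨finrank K Ext2 - boxRank n k, ?_⟩, by rw [bridge, hc], ?_⟩
  · have := boxRank_le_finrank_ext ev σ c bridge hc
    omega
  · have h1 := LinearMap.finrank_range_add_finrank_ker c
    have h2 := kerDim_add_boxRank n k
    omega

/-- **(S2) SATURATION** (STRUCTURE §2 (S2) «`δ_E = 0 ⇒ σ_E` injective in EVERY degree (saturation: `ev` onto)»; th-6
THEOREM S = tree `FormulaN.Squeeze.theoremS` at the FORMULA-N numbers): under the same hypotheses in degree `k`, `δ_E = 0` —
`dim Ext^k(E,E) = R_k(n)`, the EXTREMAL case, an INPUT here (th-7 Σ3 / EXT-NOTE Thm 1.1 on paper) — forces `ev` ONTO, `σ`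
INJECTIVE, `rank σ = R_k(n)` and `dim ker ev = kerDim n k` (`k = 2`, `n ≥ 3`: `2n²`).  (S2)'s converse for `n ≤ 4` is not typed. -/
theorem s2_saturation (ev : HT2 →ₗ[K] Ext2) (σ : Ext2 →ₗ[K] Tgt) (c : HT2 →ₗ[K] Tgt) (bridge : σ ∘ₗ ev = c)
    {n k : ℕ} (hHT : finrank K HT2 = dimHT n k) (hc : finrank K (LinearMap.range c) = boxRank n k)
    (hExt : finrank K Ext2 = boxRank n k) :
    Function.Surjective ev ∧ Function.Injective σ ∧ finrank K (LinearMap.range σ) = boxRank n k ∧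
      finrank K (LinearMap.ker ev) = kerDim n k := by
  obtain ⟨hsurj, hinj, -, hker, hσ⟩ := Squeeze.theoremS ev σ c bridge (boxRank n k) hc hExt.le
  refine ⟨hsurj, hinj, hσ, ?_⟩
  have h2 := kerDim_add_boxRank n k
  omega

end Saturation

/-! ## §5. (S3) MOD-4 PARITY LAW — arithmetic skeleton -/

/-- C12: the Euler characteristic of the extremal profile, `χ_extremal(n) := P_n(−1) = Σ_k (−1)^k r_k(n)`. -/
noncomputable def chiExtremal (n : ℕ) : ℤ := (P n).eval (-1)

/-- `P_n(−1) = −1 − (−1)^n` for `n ≥ 1`: `−2` for `n` even, `0` for `n` odd (STRUCTURE C12; th-7 Σ6). -/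
theorem chiExtremal_eq {n : ℕ} (hn : 0 < n) : chiExtremal n = -1 - (-1) ^ n := by
  simp [chiExtremal, P, eval_sub, eval_mul, eval_pow, eval_add, zero_pow hn.ne']

/-- even case: `χ_extremal = −2`. -/
theorem chiExtremal_of_even {n : ℕ} (hn : 0 < n) (he : Even n) : chiExtremal n = -2 := by
  rw [chiExtremal_eq hn, he.neg_one_pow]; norm_num

/-- odd case: `χ_extremal = 0` (no χ-constraint for `n` odd). -/
theorem chiExtremal_of_odd {n : ℕ} (ho : Odd n) : chiExtremal n = 0 := by
  rw [chiExtremal_eq ho.pos, ho.neg_one_pow]; norm_num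

/-- The two inputs of th-7's Σ6 for a HYPOTHETICAL `G`-equivariant (`G ⊂ translations`, acting freely) secant-type object with
the extremal («Lemma») `G`-invariant profile on an abelian `n`-fold, packaged BY VALUE: `cardG = |G| ≥ 1`; `vv = (v,v)_χ`, the
Mukai self-pairing of its K-secant class; (H1) `sign_law`: for `n` even `(v,v)_χ` has sign `(−1)^{n/2}` (HRR, GIVEN `∫_X bⁿ > 0`
— ARGUED from polarisability, referee-read ref-4 13:46:16Z; a hypothesis of record, not a theorem); (H-profile) `profile_law`:
`(v,v)_χ = χ(E,E) = |G| · P_n(−1)`. Nothing geometric is constructed; a `ParityDatum` is what such an object WOULD supply. -/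
structure ParityDatum (n : ℕ) where
  /-- `|G|` -/
  cardG : ℕ
  /-- `G` is a (non-empty) group -/
  cardG_pos : 0 < cardG
  /-- the Mukai self-pairing `(v,v)_χ ∈ ℤ` -/
  vv : ℤ
  /-- (H1): sign `(−1)^{n/2}` for `n` even -/
  sign_law : Even n → 0 < (-1) ^ (n / 2) * vv
  /-- (H-profile): `(v,v)_χ = |G| · χ_extremal(n)` -/
  profile_law : vv = cardG * chiExtremal n

/-- **(S3), first clause**: for `n ≡ 0 (mod 4)` the two laws are INCOMPATIBLE — no parity datum, hence (on paper) no
`G`-equivariant secant-type object with the Lemma profile on any abelian `n`-fold (at `n = 4`: the Lemma-profile half of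
NOGO-n4 / Q824-NO; the «no `G`-semiregular secant object at all» half needs the Σ5 pinch, not typed here). -/
theorem parityDatum_false_of_four_dvd {n : ℕ} (hn : 0 < n) (h4 : 4 ∣ n) (d : ParityDatum n) : False := by
  obtain ⟨m, rfl⟩ := h4
  have he : Even (4 * m) := ⟨2 * m, by ring⟩
  have h1 := d.sign_law he
  have h2 : d.vv = -2 * d.cardG := by rw [d.profile_law, chiExtremal_of_even hn he]; ring
  have h3 : (-1 : ℤ) ^ (4 * m / 2) = 1 := by
    rw [show 4 * m / 2 = 2 * m by omega, pow_mul]; norm_num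
  rw [h3, h2] at h1
  have := d.cardG_pos
  omega

/-- **(S3), second clause**: for `n ≡ 2 (mod 4)` the laws are sign-consistent and FIX the group order:
`2·|G| = −(v,v)_χ` (the design constraint «`|G| = −(v,v)_χ/2`»; `n = 2`, T4a: `|G| = 1`). -/
theorem two_mul_cardG_eq {n : ℕ} (h2 : n % 4 = 2) (d : ParityDatum n) : 2 * (d.cardG : ℤ) = -d.vv := by
  have he : Even n := ⟨n / 4 * 2 + 1, by omega⟩
  rw [d.profile_law, chiExtremal_of_even (by omega) he]; ring

/-! ## §6. (S4) THE CONJECTURE PROPER and the n-pattern of the law, as a SHAPE -/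

/-- OF RECORD (not proved here): extremal class-alive secant factors exist at `n = 2` (T4a; [Mar25], Weil-type FOURFOLDS) and
`n = 3` (t-13 family C C13-8, ×2; THETA-SECANT): both on SPLIT components — method instances (STRUCTURE (S4), D6). -/
def S4Record (E : ℕ → Prop) : Prop := E 2 ∧ E 3

/-- (S3) as an exclusion pattern: nothing at `n ≡ 0 (mod 4)`, `n > 0`. -/
def S3Exclusion (E : ℕ → Prop) : Prop := ∀ n, 0 < n → 4 ∣ n → ¬ E n

/-- **(S4) THE CONJECTURE PROPER — OPEN** (STRUCTURE §2 (S4), VERDICT-G6 § FORMULA-N / STRUCTURE): extremal CLASS-ALIVE secant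
factors (hence semiregular class-exact boxes on the split component `(n, K, (−1)ⁿ·Nm)`) EXIST at `n = 5` and at every
`n ≡ 2 (mod 4)`, `n ≥ 6` (Markman-type `G`-designs with `|G| = −(v,v)_χ/2`). Witness test of record at `n = 5` = family S:
«8/8 NOT semiregular ×2 EXACT; no witness» (R-81 (a)); the `n = 6` rung sieved arithmetically (p1 N6-SIEVE). An open
`Prop`-schema, never asserted. -/
def S4Conjecture (E : ℕ → Prop) : Prop := E 5 ∧ ∀ n, 6 ≤ n → n % 4 = 2 → E n

/-- The n-PATTERN of the K-isotypic saturation law for an existence predicate `E` («there is an extremal class-alive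
N-transversal 2-secant factor on some abelian `n`-fold»; `-- TODO(real carrier)`: not definable in the tree today):
record ∧ exclusion ∧ conjecture, kept as three SEPARATELY-TIERED fields. The SCOPE CAVEAT of record applies: every
secant-structure row lives on a SPLIT component, so (S) decides nothing at its own `g`; its deciding power is the LADDER
(STRUCTURE §3.0). -/
structure SaturationLawShape (E : ℕ → Prop) : Prop where
  /-- `E 2 ∧ E 3` — OF RECORD (printed / census), not proved in the tree -/
  record : S4Record E
  /-- nothing at `n ≡ 0 (mod 4)` — (S3), proved on paper given (H1) -/
  exclusion : S3Exclusion E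
  /-- `E 5` and `E n` for `n ≥ 6`, `n ≡ 2 (mod 4)` — (S4), OPEN -/
  conjecture : S4Conjecture E

/-- The kernel content of (S3) for the shape: if every witness of `E n` would carry a `ParityDatum n` (th-7 Σ6's two inputs),
then `E` is excluded at every positive multiple of `4`. -/
theorem s3Exclusion_of_parityDatum (E : ℕ → Prop) (h : ∀ n, E n → Nonempty (ParityDatum n)) : S3Exclusion E :=
  fun n hn h4 hE => (h n hE).elim fun d => parityDatum_false_of_four_dvd hn h4 d

/-- Sanity of the shape (no hidden contradiction between its three fields): the residues named by `S4Record` /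
`S4Conjecture` (`2, 3, 5` and `≡ 2 (mod 4)`) avoid the excluded class `≡ 0 (mod 4)`; e.g. the predicate «`n % 4 ≠ 0`» realises
the shape. (This says nothing about the intended geometric `E`.) -/
theorem saturationLawShape_consistent : SaturationLawShape fun n => n % 4 ≠ 0 where
  record := ⟨by decide, by decide⟩
  exclusion := fun n _ h4 h => h (Nat.mod_eq_zero_of_dvd h4)
  conjecture := ⟨by decide, fun n _ h => by omega⟩

end Summit.Ventures.HSemireg.FormulaN.Uniform
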